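import Literature.MathematicalPhysics.QuantumLattice.KomaPiFluxVariationalEnergy
import HarnessLib

/-!
# The long-range-order bound of Koma 2022, (6.34)–(6.36), in finite volume (Lieb frame)

T. Koma, *Nambu–Goldstone modes for superconducting lattice fermions*, arXiv:2201.13135 (2022)
[Koma2022], §6 and Appendix B: the superconducting long-range order `m_LRO` of the `π`-flux BCS
lattice fermions obeys (6.34)–(6.35),
`√E₁(√E₁ - I_d/√2) - δ(β) - I_d√(|κ|/g) ≤ (m_LRO)²`, with `E₁ ≥ ½ - δ̃(β)/(dg) - |κ|/g` (6.36), so that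
long-range order exists at low temperature and small `|κ|/g` as soon as the lattice constant `I_d`
((6.24)) is small enough (`I_3 = 0.68…`, `I_4 = 0.44…`).

This file states the two finite-volume inequalities of this series' formalisation in normalised
form, for `H₀ = H(κ,U,g,0,0)` on the torus of even side `L ≥ 4` in dimension `D = d+1`
(`|Λ| = L^D`), inverse temperature `β > 0`, `κ ≥ 0`, `g > 0`:

* `KomaPiFlux.lroSq_ge` ((6.34) with this series' constants):
  `m² ≥ E₁ - δ_Λ(β) - ½ I_{D,Λ} √(8κ/g + 4E₁)`, where `m² = lroSq` ((6.18)–(6.19)),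
  `E₁ = nnCorr = (D|Λ|)⁻¹ Σ_iΣ_x Re⟨Γ¹_xΓ¹_{x+e_i}⟩` ((6.32)), `δ_Λ(β) = (βgD|Λ|)⁻¹ Σ_{q≠0}{C_q}₊/E_q`
  ((6.21)) and `I²_{D,Λ} = (D|Λ|)⁻¹ Σ_{q≠0} {C_q}₊²/E_q` ((6.24); `C_q = Σ_i cos q_i`, `E_q = Σ_i(1 - cos q_i)`);
* `KomaPiFlux.nnCorr_ge` ((6.36)): `E₁ ≥ ½ - {U + 2gD}₊/(2gD) - 4κ/g - log 4/(βgD)`.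

(The infrared constant of this series is `1/(βgE_p)`, twice Koma's (6.11); accordingly the
`I`-term reads `½I√(8κ/g + 4E₁) = I√(2κ/g + E₁)` instead of Koma's `I√(κ/g) + I√(E₁/2)`, and the
zero-temperature, `κ → 0` threshold is `I < 1/√2`.) No named fact.

## References

* [Koma2022] T. Koma, arXiv:2201.13135, (6.18)–(6.24), (6.32)–(6.36), Theorem 2.1.
-/

noncomputable section

namespace Literature.MathematicalPhysics.QuantumLattice

open Matrix Finset HubbardWave0 PairHopRP FermionTorus LiebCutRP
open Literature.Probability.LatticeModels

namespace KomaPiFlux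

attribute [local instance] LiebCutRP.decEqTorus

variable {d L : ℕ} [NeZero L]

/-- The nearest-neighbour `η` correlation per bond, `E₁ = (D|Λ|)⁻¹ Σ_i Σ_x Re⟨Γ¹_xΓ¹_{x+e_i}⟩`
(Koma's `E^{(Λ)}_1`, (6.32), in the Lieb frame; by the axis symmetry all directions contribute equally,
here we simply average). [cite: Koma2022, (6.32)] -/
def nnCorr (β : ℝ) (H : Matrix (Finset (Orb (FermionTorus (d + 1) L))) (Finset (Orb (FermionTorus (d + 1) L))) ℂ) : ℝ :=
  (∑ i : Fin (d + 1), ∑ x : FermionTorus (d + 1) L, pairCorr β H x (shift x i)) / ((d + 1) * (L : ℝ) ^ (d + 1))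

omit [NeZero L] in
/-- The thermal lattice sum `Σ_{q≠0} {C_q}₊/E_q` of (6.21) (without the prefactor `1/(2dβg|Λ|)`).
[cite: Koma2022, (6.21)] -/
def thermalSum (d L : ℕ) [NeZero L] : ℝ :=
  ∑ q ∈ (univ : Finset (TorusSite (d + 1) L)).erase 0, max (torusCosSum L q) 0 / dispersion (latticeMomentum L q)

omit [NeZero L] in
/-- The squared lattice constant `I²_{D,Λ} = (D|Λ|)⁻¹ Σ_{q≠0} {C_q}₊²/E_q` of (6.24) (finite volume,
Lieb frame: Koma's `{-Σcos p}₊²/E_{p+Q}` after the shift `p ↦ p + Q`). [cite: Koma2022, (6.24)] -/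
def idSq (d L : ℕ) [NeZero L] : ℝ :=
  (∑ q ∈ (univ : Finset (TorusSite (d + 1) L)).erase 0, (max (torusCosSum L q) 0) ^ 2 / dispersion (latticeMomentum L q)) /
    ((d + 1) * (L : ℝ) ^ (d + 1))

omit [NeZero L] in
/-- `I²_{D,Λ} ≥ 0`. [cite: Koma2022, (6.24)] -/
theorem idSq_nonneg (d L : ℕ) [NeZero L] : 0 ≤ idSq d L :=
  div_nonneg (Finset.sum_nonneg fun q _ => div_nonneg (sq_nonneg _) (dispersion_nonneg _)) (by positivity)

/-- **(6.34), finite volume** (this series' constants): for `H₀ = H(κ,U,g,0,0)`, even `L ≥ 4`, `β > 0`,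
`κ ≥ 0`, `g > 0`:
`m² ≥ E₁ - thermalSum/(βgD|Λ|) - ½ √(I²_{D,Λ}) √(8κ/g + 4E₁)`. [cite: Koma2022, (6.23), (6.33)–(6.34)] -/
theorem lroSq_ge (hL : Even L) (h4 : 4 ≤ L) {β : ℝ} (hβ : 0 < β) {κ : ℝ} (hκ : 0 ≤ κ) (U : ℝ) {g : ℝ}
    (hg : 0 < g) :
    nnCorr β (hamiltonian κ U g (fun (_ _ : FermionTorus (d + 1) L) => (0 : ℝ)) 0) -
        thermalSum d L / (β * g * ((d + 1) * (L : ℝ) ^ (d + 1))) -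
        1 / 2 * Real.sqrt (idSq d L) *
          Real.sqrt (8 * κ / g + 4 * nnCorr β (hamiltonian κ U g (fun (_ _ : FermionTorus (d + 1) L) => (0 : ℝ)) 0)) ≤
      lroSq β (hamiltonian κ U g (fun (_ _ : FermionTorus (d + 1) L) => (0 : ℝ)) 0) := by
  set H₀ := hamiltonian κ U g (fun (_ _ : FermionTorus (d + 1) L) => (0 : ℝ)) 0 with hH₀
  have hkls := koma_kls (d := d) hL h4 hβ hκ U hg
  rw [← hH₀] at hkls
  set N₁ := ∑ i : Fin (d + 1), ∑ x : FermionTorus (d + 1) L, pairCorr β H₀ x (shift x i) with hN₁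
  set Λr : ℝ := (L : ℝ) ^ (d + 1) with hΛr
  set Dr : ℝ := (d + 1 : ℝ) with hDr
  set J := ∑ q ∈ (univ : Finset (TorusSite (d + 1) L)).erase 0,
    (max (torusCosSum L q) 0) ^ 2 / dispersion (latticeMomentum L q) with hJ
  have hΛ : 0 < Λr := by
    have : (0 : ℝ) < L := by exact_mod_cast (show 0 < L by omega)
    positivity
  have hD : 0 < Dr := by rw [hDr]; positivity
  have hcard : (Fintype.card (FermionTorus (d + 1) L) : ℝ) = Λr := by
    rw [show Fintype.card (FermionTorus (d + 1) L) = L ^ (d + 1) by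
      simp only [FermionTorus, Fintype.card_lex, Fintype.card_fun, Fintype.card_fin], Nat.cast_pow]
  rw [hcard] at hkls
  have hJ0 : 0 ≤ J := Finset.sum_nonneg fun q _ => div_nonneg (sq_nonneg _) (dispersion_nonneg _)
  have hI : idSq d L = J / (Dr * Λr) := by simp only [idSq, hJ, hDr, hΛr]
  have hE : nnCorr β H₀ = N₁ / (Dr * Λr) := by simp only [nnCorr, hN₁, hDr, hΛr]
  -- the square-root term, normalised
  have hsqrt : 1 / 2 * Real.sqrt (Λr / g * J) * Real.sqrt (Λr * (8 * (d + 1) * κ * Λr + 4 * g * N₁)) =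
      Dr * Λr ^ 2 * (1 / 2 * Real.sqrt (idSq d L) * Real.sqrt (8 * κ / g + 4 * nnCorr β H₀)) := by
    have e4 : (Dr * Λr ^ 2) ^ 2 * (idSq d L * (8 * κ / g + 4 * nnCorr β H₀)) =
        Λr / g * J * (Λr * (8 * (d + 1) * κ * Λr + 4 * g * N₁)) := by
      rw [hI, hE, hDr]
      field_simp
    calc 1 / 2 * Real.sqrt (Λr / g * J) * Real.sqrt (Λr * (8 * (d + 1) * κ * Λr + 4 * g * N₁))
        = 1 / 2 * Real.sqrt (Λr / g * J * (Λr * (8 * (d + 1) * κ * Λr + 4 * g * N₁))) := by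
          rw [mul_assoc, ← Real.sqrt_mul (by positivity)]
      _ = 1 / 2 * Real.sqrt ((Dr * Λr ^ 2) ^ 2 * (idSq d L * (8 * κ / g + 4 * nnCorr β H₀))) := by rw [e4]
      _ = 1 / 2 * (Dr * Λr ^ 2 * (Real.sqrt (idSq d L) * Real.sqrt (8 * κ / g + 4 * nnCorr β H₀))) := by
          rw [Real.sqrt_mul (sq_nonneg _), Real.sqrt_sq (by positivity), Real.sqrt_mul (idSq_nonneg d L)]
      _ = Dr * Λr ^ 2 * (1 / 2 * Real.sqrt (idSq d L) * Real.sqrt (8 * κ / g + 4 * nnCorr β H₀)) := by ring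
  -- normalise the KLS inequality
  have hgoal : Dr * Λr ^ 2 * (nnCorr β H₀ - thermalSum d L / (β * g * (Dr * Λr)) -
      1 / 2 * Real.sqrt (idSq d L) * Real.sqrt (8 * κ / g + 4 * nnCorr β H₀)) ≤ Dr * Λr ^ 2 * lroSq β H₀ := by
    have eN : Dr * Λr ^ 2 * nnCorr β H₀ = Λr * N₁ := by
      rw [hE]; field_simp
    have eT : Dr * Λr ^ 2 * (thermalSum d L / (β * g * (Dr * Λr))) = Λr / (β * g) * thermalSum d L := by
      field_simp
    rw [mul_sub, mul_sub, eN, eT, ← hsqrt]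
    unfold thermalSum
    linarith [hkls]
  have hpos : 0 < Dr * Λr ^ 2 := by positivity
  exact le_of_mul_le_mul_left (by simpa only [hDr] using hgoal) hpos

/-- **(6.36), finite volume**: `E₁ ≥ ½ - {U + 2g(d+1)}₊/(2g(d+1)) - 4κ/g - log 4/(βg(d+1))`
(even `L ≥ 4`, `β > 0`, `κ ≥ 0`, `g > 0`). [cite: Koma2022, (6.36)] -/
theorem nnCorr_ge (hL : Even L) (h4 : 4 ≤ L) {β : ℝ} (hβ : 0 < β) {κ : ℝ} (hκ : 0 ≤ κ) (U : ℝ) {g : ℝ}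
    (hg : 0 < g) :
    1 / 2 - max (U + 2 * g * (d + 1)) 0 / (2 * g * (d + 1)) - 4 * κ / g - Real.log 4 / (β * g * (d + 1)) ≤
      nnCorr β (hamiltonian κ U g (fun (_ _ : FermionTorus (d + 1) L) => (0 : ℝ)) 0) := by
  have h := nearestNeighbour_ge (d := d) hL h4 hβ hκ U hg.le
  have hΛ : (0 : ℝ) < (L : ℝ) ^ (d + 1) := by
    have : (0 : ℝ) < L := by exact_mod_cast (show 0 < L by omega)
    positivity
  have hD : (0 : ℝ) < (d + 1 : ℝ) := by positivity
  unfold nnCorr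
  rw [le_div_iff₀ (by positivity)]
  have hid : (1 / 2 - max (U + 2 * g * (d + 1)) 0 / (2 * g * (d + 1)) - 4 * κ / g - Real.log 4 / (β * g * (d + 1))) *
      ((d + 1) * (L : ℝ) ^ (d + 1)) =
      (g * (d + 1) * (L : ℝ) ^ (d + 1) / 2 - max (U + 2 * g * (d + 1)) 0 * (L : ℝ) ^ (d + 1) / 2 -
        4 * (d + 1) * κ * (L : ℝ) ^ (d + 1) - (L : ℝ) ^ (d + 1) * Real.log 4 / β) / g := by
    field_simp
  rw [hid, div_le_iff₀ hg]
  linarith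

end KomaPiFlux

end Literature.MathematicalPhysics.QuantumLattice

end
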